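import Literature.NumberTheory.BeurlingPrimes.HilberdinkNonvanishing
import Literature.NumberTheory.LFunctions.RHInvZetaBound
import HarnessLib

/-!
# Hilberdink's uncertainty principle, V: `ζ_P` has zero order on `Re s > θ` (Hilberdink–Lapidus Thm 2.3)

Topic `Literature/NumberTheory/BeurlingPrimes`, grouping namespace `Hilberdink`. Everything in this
file is PROVED. Hilberdink–Lapidus 2006, Theorem 2.3 ("Theorem A" of Hilberdink 2005, §3): "Let
`𝒫` be a `[α, β]`-system. Then for `σ > Θ = max{α, β}`, and uniformly for `σ ≥ Θ + δ` (any
`δ > 0`), … `ζ(σ + it) = O(|t|^ε)` for all `ε > 0`." Proof (ibid.): `ζ` and `φ` continue with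
`O(|t|)` bounds; "`ζ(s)` is non-zero for `Re s > α`, and so `log ζ(s)` exists … `Re log ζ(σ+it) =
log|ζ(σ+it)| ≤ A log|t|`. Applying the Borel–Carathéodory Theorem … `|log ζ(σ+it)| = O(log|t|)`
… Hadamard's Three-Circles Theorem … `|ζ(σ+it)| = O(|t|^ε)`."

We follow the disc geometry of the tree's `RHInvZetaBound.lean` (Titchmarsh §14.2: three circles
applied to `log ζ` itself rather than to `φ`), for the continuation `Z` of `ζ_P` (file IV) of a system
with `|N_P(x) − ax| ≤ Cx^θ`, `|ψ_P(x) − x| ≤ Cx^θ` (`x ≥ 1`, `a > 0`, `0 ≤ θ < 1`):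
* discs centred `5/2 + it` of radius `R₀ = 5/2 − θ − δ/2` lie in `{Re > θ} ∖ {1}` for `|t| ≥ 7`;
  there `Z` is holomorphic, zero-free and `‖Z‖ ≤ |t|²` for `|t| ≥ T₁` (`norm_Z_le_sq`);
* `exists_log_Z`: a holomorphic `G` with `exp G = Z` on the disc, `G = L` (Euler logarithm) on
  `Re z > 1`, and `‖G‖ ≤ A₃δ⁻¹ log|t|` on the disc of radius `5/2 − θ − δ` (Borel–Carathéodory);
* the three-circles step and the conclusions `Z(σ+it) = O(|t|^ε)`,
  `‖∫₁^∞ E x^{−σ₁−1+it}dx‖ ≤ K(1+|t|)^{ε−1}` are in the continuation file `HilberdinkLindelof.lean`.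

## References
* T. W. Hilberdink, M. L. Lapidus, *Beurling zeta functions, generalised primes, and fractal
  membranes*, Acta Appl. Math. 94 (2006), arXiv:math/0410270, Theorem 2.3 and its proof.
* [Hilberdink2005] T. W. Hilberdink, *Well-behaved Beurling primes and integers*, J. Number Theory
  112 (2005) 332–344, §3 Theorem A.
* E. C. Titchmarsh, *The Theory of the Riemann Zeta-Function*, 2nd ed. (1986), §14.2 (the disc
  geometry, as in the tree's `RHInvZetaBound.lean`).
-/

noncomputable section

open Set Filter Complex Metric
open scoped Topology Real

namespace Literature.NumberTheory.BeurlingPrimes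

open Literature.Barriers.RiemannHypothesis
open Literature.NumberTheory.LFunctions.InvZetaRH (norm_le_of_three_circles exists_log_of_ball one_le_log_abs)

namespace Hilberdink

variable {P : BeurlingPrimes} {a C θ δ t : ℝ}

/-! ### Constants and disc geometry -/

/-- The bound `B_L = (1 + (1 − λ₀^{−3/2})⁻¹/2) ∑_j λ_j^{−3/2}` for `‖L(s)‖` on `Re s ≥ 3/2`. [folklore] -/
def BL (P : BeurlingPrimes) : ℝ :=
  (1 + (1 - P.prime 0 ^ (-(3 / 2 : ℝ)))⁻¹ / 2) * ∑' j, P.prime j ^ (-(3 / 2 : ℝ))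

/-- `‖L(s)‖ ≤ B_L` for `Re s ≥ 3/2` (when `N_P(x) ≤ Bx`). [folklore] -/
theorem norm_eulerLog_le_BL {B : ℝ} (hB : ∀ x : ℝ, 1 ≤ x → (P.intCount x : ℝ) ≤ B * x)
    {s : ℂ} (hs : 3 / 2 ≤ s.re) : ‖eulerLog P s‖ ≤ BL P :=
  norm_eulerLog_le hB (by norm_num) hs

/-- `0 ≤ B_L`. [folklore] -/
theorem BL_nonneg (P : BeurlingPrimes) : 0 ≤ BL P := by
  unfold BL
  refine mul_nonneg ?_ (tsum_nonneg fun j ↦ Real.rpow_nonneg (P.prime_pos j).le _)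
  have : P.prime 0 ^ (-(3 / 2 : ℝ)) < 1 := Real.rpow_lt_one_of_one_lt_of_neg P.one_lt (by norm_num)
  have : 0 ≤ (1 - P.prime 0 ^ (-(3 / 2 : ℝ)))⁻¹ := inv_nonneg.mpr (by linarith)
  linarith

/-- Centre `5/2 + it` of the discs. [folklore] -/
def dctr (t : ℝ) : ℂ := 5 / 2 + t * I

/-- `Re(5/2 + it) = 5/2`. [folklore] -/
@[simp] lemma dctr_re (t : ℝ) : (dctr t).re = 5 / 2 := by simp [dctr]

/-- `Im(5/2 + it) = t`. [folklore] -/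
@[simp] lemma dctr_im (t : ℝ) : (dctr t).im = t := by simp [dctr]

/-- Radius `R₀ = 5/2 − θ − δ/2` of the Borel–Carathéodory disc (reaching `Re z = θ + δ/2`). [folklore] -/
def R₀ (θ δ : ℝ) : ℝ := 5 / 2 - θ - δ / 2

/-- Radius `r₃ = 5/2 − θ − δ` of the outer three-circles circle. [folklore] -/
def r₃ (θ δ : ℝ) : ℝ := 5 / 2 - θ - δ

/-- `A₃ = 20 + 10 B_L`, the constant in `‖G‖ ≤ A₃ δ⁻¹ log|t|`. [folklore] -/
def A₃ (P : BeurlingPrimes) : ℝ := 20 + 10 * BL P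

/-- `B₂ = max(B_L, 1)`, the bound on the inner circle. [folklore] -/
def B₂ (P : BeurlingPrimes) : ℝ := max (BL P) 1

/-- The three-circles exponent `a₀ = log(5/2 − θ − 2δ)/log(5/2 − θ − δ) < 1`. [folklore] -/
def a₀ (θ δ : ℝ) : ℝ := Real.log (5 / 2 - θ - 2 * δ) / Real.log (5 / 2 - θ - δ)

/-- `‖5/2 + it‖ ≤ 5/2 + |t|`. [folklore] -/
lemma norm_dctr_le (t : ℝ) : ‖dctr t‖ ≤ 5 / 2 + |t| := by
  unfold dctr
  calc ‖(5 / 2 : ℂ) + t * I‖ ≤ ‖(5 / 2 : ℂ)‖ + ‖(t : ℂ) * I‖ := norm_add_le _ _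
    _ = 5 / 2 + |t| := by simp [Complex.norm_real]

/-- Points of the disc have `Re z > θ + δ/2`. [folklore] -/
lemma re_gt_of_mem_ball {z : ℂ} (hz : z ∈ ball (dctr t) (R₀ θ δ)) : θ + δ / 2 < z.re := by
  have h := abs_re_le_norm (z - dctr t)
  rw [mem_ball, dist_eq_norm] at hz
  simp only [sub_re, dctr_re] at h
  unfold R₀ at hz
  have := neg_abs_le (z.re - 5 / 2)
  linarith

/-- Points of the disc have `|Im z| ≥ 1` once `|t| ≥ 7`. [folklore] -/
lemma one_le_abs_im_of_mem_ball (hθ : 0 ≤ θ) (hδ : 0 < δ) (ht : 7 ≤ |t|) {z : ℂ}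
    (hz : z ∈ ball (dctr t) (R₀ θ δ)) : 1 ≤ |z.im| := by
  have h := abs_im_le_norm (z - dctr t)
  rw [mem_ball, dist_eq_norm] at hz
  simp only [sub_im, dctr_im] at h
  unfold R₀ at hz
  have h1 : |z.im - t| < 5 / 2 := by linarith
  have := abs_sub_abs_le_abs_sub t z.im
  rw [abs_sub_comm] at this
  linarith

/-- Points of the disc have `‖z‖ ≤ |t| + 5`. [folklore] -/
lemma norm_le_of_mem_ball (hθ : 0 ≤ θ) (hδ : 0 < δ) {z : ℂ} (hz : z ∈ ball (dctr t) (R₀ θ δ)) :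
    ‖z‖ ≤ |t| + 5 := by
  rw [mem_ball, dist_eq_norm] at hz
  unfold R₀ at hz
  have h := norm_dctr_le t
  calc ‖z‖ = ‖(z - dctr t) + dctr t‖ := by rw [sub_add_cancel]
    _ ≤ ‖z - dctr t‖ + ‖dctr t‖ := norm_add_le _ _
    _ ≤ |t| + 5 := by linarith

/-- The disc avoids the pole `1`. [folklore] -/
lemma ne_one_of_mem_ball (hθ : 0 ≤ θ) (hδ : 0 < δ) (ht : 7 ≤ |t|) {z : ℂ} (hz : z ∈ ball (dctr t) (R₀ θ δ)) :
    z ≠ 1 := by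
  intro h
  have := one_le_abs_im_of_mem_ball hθ hδ ht hz
  rw [h] at this
  norm_num at this

/-- `‖z − 1‖ ≥ 1` on the disc. [folklore] -/
lemma one_le_norm_sub_one_of_mem_ball (hθ : 0 ≤ θ) (hδ : 0 < δ) (ht : 7 ≤ |t|) {z : ℂ}
    (hz : z ∈ ball (dctr t) (R₀ θ δ)) : 1 ≤ ‖z - 1‖ := by
  have h := one_le_abs_im_of_mem_ball hθ hδ ht hz
  have := abs_im_le_norm (z - 1)
  simp only [sub_im, one_im, sub_zero] at this
  linarith

/-- The disc lies in `{Re > θ} ∖ {1}`. [folklore] -/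
lemma mem_dom_of_mem_ball (hθ : 0 ≤ θ) (hδ : 0 < δ) (ht : 7 ≤ |t|) {z : ℂ} (hz : z ∈ ball (dctr t) (R₀ θ δ)) :
    z ∈ {s : ℂ | θ < s.re ∧ s ≠ 1} :=
  ⟨by linarith [re_gt_of_mem_ball hz], ne_one_of_mem_ball hθ hδ ht hz⟩

/-- The threshold `T₁ = max 7 (2(a + 2C/δ))` beyond which `‖Z‖ ≤ |t|²` on the discs. [folklore] -/
def T₁ (a C δ : ℝ) : ℝ := max 7 (2 * (a + 2 * C / δ))

/-- `a₀ < 1`. [folklore] -/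
lemma a₀_lt_one (hθ : θ < 1) (hδ : 0 < δ) (hδ2 : δ ≤ 1 / 4) : a₀ θ δ < 1 := by
  unfold a₀
  rw [div_lt_one (Real.log_pos (by linarith))]
  exact Real.log_lt_log (by linarith) (by linarith)

/-- `0 ≤ a₀`. [folklore] -/
lemma a₀_nonneg (hθ : θ < 1) (hδ : 0 < δ) (hδ2 : δ ≤ 1 / 4) : 0 ≤ a₀ θ δ := by
  unfold a₀
  exact div_nonneg (Real.log_nonneg (by linarith)) (Real.log_nonneg (by linarith))

/-- `1 ≤ B₂`. [folklore] -/
lemma one_le_B₂ (P : BeurlingPrimes) : 1 ≤ B₂ P := le_max_right _ _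

/-- `40 ≤ A₃/δ` for `0 < δ ≤ 1/2`. [folklore] -/
lemma forty_le_A₃_div (P : BeurlingPrimes) (hδ : 0 < δ) (hδ2 : δ ≤ 1 / 2) : 40 ≤ A₃ P / δ := by
  rw [le_div_iff₀ hδ]
  unfold A₃
  nlinarith [BL_nonneg P]

section hyp

/-- `Z` is holomorphic on the disc. [cite: Hilberdink2005, §3 Theorem A] -/
theorem differentiableOn_Z_ball (hθ0 : 0 ≤ θ) (hN : ∀ x : ℝ, 1 ≤ x → |(P.intCount x : ℝ) - a * x| ≤ C * x ^ θ)
    (hδ : 0 < δ) (ht : 7 ≤ |t|) :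
    DifferentiableOn ℂ (Z P a) (ball (dctr t) (R₀ θ δ)) :=
  (differentiableOn_Z hN).mono fun _ hz ↦ mem_dom_of_mem_ball hθ0 hδ ht hz

/-- `Z ≠ 0` on the disc. [cite: Hilberdink2005, §3 Theorem A] -/
theorem Z_ne_zero_ball (ha : 0 < a) (hθ0 : 0 ≤ θ) (hθ : θ < 1) (hN : ∀ x : ℝ, 1 ≤ x → |(P.intCount x : ℝ) - a * x| ≤ C * x ^ θ)
    (hψ : ∀ x : ℝ, 1 ≤ x → |P.chebyshevPsi x - x| ≤ C * x ^ θ) (hδ : 0 < δ) (ht : 7 ≤ |t|) {z : ℂ}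
    (hz : z ∈ ball (dctr t) (R₀ θ δ)) : Z P a z ≠ 0 :=
  Z_ne_zero ha hθ hN hψ (by linarith [re_gt_of_mem_ball hz]) (ne_one_of_mem_ball hθ0 hδ ht hz)

/-- **Finite order on the discs**: `‖Z z‖ ≤ |t|²` for `z` in the disc, `|t| ≥ T₁`. [cite: Hilberdink2005, §3 Theorem A] -/
theorem norm_Z_le_sq (ha : 0 < a) (hθ0 : 0 ≤ θ) (hN : ∀ x : ℝ, 1 ≤ x → |(P.intCount x : ℝ) - a * x| ≤ C * x ^ θ)
    (hδ : 0 < δ) (ht : T₁ a C δ ≤ |t|) {z : ℂ} (hz : z ∈ ball (dctr t) (R₀ θ δ)) :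
    ‖Z P a z‖ ≤ |t| ^ 2 := by
  have ht7 : 7 ≤ |t| := le_trans (le_max_left _ _) ht
  have htK : 2 * (a + 2 * C / δ) ≤ |t| := le_trans (le_max_right _ _) ht
  have hC : 0 ≤ C := const_nonneg hN
  have hre := re_gt_of_mem_ball hz
  have hz1 := one_le_norm_sub_one_of_mem_ball hθ0 hδ ht7 hz
  have hzn := norm_le_of_mem_ball hθ0 hδ hz
  have h := norm_Z_le ha.le hN (s := z) (by linarith) (ne_one_of_mem_ball hθ0 hδ ht7 hz)
  -- `a‖z‖/‖z−1‖ ≤ a‖z‖`, `C/(Re z − θ) ≤ 2C/δ`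
  have h1 : a * ‖z‖ / ‖z - 1‖ ≤ a * ‖z‖ := div_le_self (by positivity) hz1
  have h2 : C / (z.re - θ) ≤ 2 * C / δ := by
    rw [div_le_div_iff₀ (by linarith) hδ]; nlinarith
  have h3 : ‖Z P a z‖ ≤ (a + 2 * C / δ) * ‖z‖ := by
    calc ‖Z P a z‖ ≤ a * ‖z‖ / ‖z - 1‖ + ‖z‖ * (C / (z.re - θ)) := h
      _ ≤ a * ‖z‖ + ‖z‖ * (2 * C / δ) := add_le_add h1 (mul_le_mul_of_nonneg_left h2 (norm_nonneg _))
      _ = (a + 2 * C / δ) * ‖z‖ := by ring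
  have hK : 0 ≤ a + 2 * C / δ := by positivity
  calc ‖Z P a z‖ ≤ (a + 2 * C / δ) * ‖z‖ := h3
    _ ≤ (a + 2 * C / δ) * (2 * |t|) := mul_le_mul_of_nonneg_left (by linarith) hK
    _ = 2 * (a + 2 * C / δ) * |t| := by ring
    _ ≤ |t| * |t| := mul_le_mul_of_nonneg_right htK (abs_nonneg t)
    _ = |t| ^ 2 := (sq _).symm

/-- **The holomorphic logarithm with the Borel–Carathéodory bound** (Hilberdink–Lapidus, proof of
Thm 2.3; Titchmarsh (14.2.2)): for `0 < δ ≤ 1/2` and `|t| ≥ T₁` there is a holomorphic `G` on the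
disc `‖z − (5/2+it)‖ < 5/2 − θ − δ/2` with `exp G = Z`, `G = L` for `Re z > 1`, and
`‖G z‖ ≤ A₃ δ⁻¹ log|t|` for `‖z − (5/2+it)‖ ≤ 5/2 − θ − δ`. [cite: Hilberdink2005, §3 Theorem A] -/
theorem exists_log_Z (ha : 0 < a) (hθ0 : 0 ≤ θ) (hθ : θ < 1) (hN : ∀ x : ℝ, 1 ≤ x → |(P.intCount x : ℝ) - a * x| ≤ C * x ^ θ)
    (hψ : ∀ x : ℝ, 1 ≤ x → |P.chebyshevPsi x - x| ≤ C * x ^ θ) (hδ : 0 < δ) (hδ2 : δ ≤ 1 / 2) (ht : T₁ a C δ ≤ |t|) :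
    ∃ G : ℂ → ℂ, DifferentiableOn ℂ G (ball (dctr t) (R₀ θ δ)) ∧
      (∀ z ∈ ball (dctr t) (R₀ θ δ), exp (G z) = Z P a z) ∧
      (∀ z ∈ ball (dctr t) (R₀ θ δ), 1 < z.re → G z = eulerLog P z) ∧
      ∀ z ∈ closedBall (dctr t) (r₃ θ δ), ‖G z‖ ≤ A₃ P / δ * Real.log |t| := by
  have ht7 : 7 ≤ |t| := le_trans (le_max_left _ _) ht
  have hB := intCount_le_of_abs_le P hθ.le hN
  have hR₀ : 0 < R₀ θ δ := by unfold R₀; linarith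
  set c : ℂ := dctr t with hc
  have hf := differentiableOn_Z_ball hθ0 hN hδ ht7 (t := t)
  have hf0 : ∀ z ∈ ball c (R₀ θ δ), Z P a z ≠ 0 := fun z hz ↦ Z_ne_zero_ball ha hθ0 hθ hN hψ hδ ht7 hz
  obtain ⟨G, hGd, hGc, hGder, hexp⟩ := exists_log_of_ball hR₀ hf hf0
  -- replace `G` by `G − G c + L c` so that `G c = L c` (exp unchanged up to the constant: redo)
  -- Instead: `exists_log_of_ball` normalises `G c = log (Z c)`; we shift by the constant `L c − log(Z c)`,
  -- which is a multiple of `2πi` since `exp(L c) = Z c`.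
  have hcV : 1 < c.re := by rw [hc, dctr_re]; norm_num
  have hcball : c ∈ ball c (R₀ θ δ) := mem_ball_self hR₀
  have hexpc : exp (eulerLog P c) = Z P a c := (Z_eq_exp_eulerLog hθ.le hN hcV).symm
  obtain ⟨n, hn⟩ : ∃ n : ℤ, eulerLog P c = G c + n * (2 * π * I) := by
    have h1 : exp (eulerLog P c) = exp (G c) := by rw [hexpc, hexp c hcball]
    exact Complex.exp_eq_exp_iff_exists_int.mp h1
  set G' : ℂ → ℂ := fun z ↦ G z + n * (2 * π * I) with hG'
  have hG'd : DifferentiableOn ℂ G' (ball c (R₀ θ δ)) := hGd.add (differentiableOn_const _)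
  have hG'exp : ∀ z ∈ ball c (R₀ θ δ), exp (G' z) = Z P a z := by
    intro z hz
    rw [hG', Complex.exp_add, Complex.exp_int_mul_two_pi_mul_I, mul_one, hexp z hz]
  have hG'der : ∀ z ∈ ball c (R₀ θ δ), HasDerivAt G' (deriv (Z P a) z / Z P a z) z :=
    fun z hz ↦ by simpa [hG'] using (hGder z hz).add_const (n * (2 * π * I))
  have hG'c : G' c = eulerLog P c := by rw [hG']; simp only; rw [hn]
  -- agreement with `L` on `V = ball ∩ {Re > 1}`
  have hV : ∀ z ∈ ball c (R₀ θ δ), 1 < z.re → G' z = eulerLog P z := by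
    set V : Set ℂ := ball c (R₀ θ δ) ∩ {z : ℂ | 1 < z.re} with hVdef
    have hVo : IsOpen V := isOpen_ball.inter (isOpen_lt continuous_const continuous_re)
    have hVc : IsPreconnected V :=
      ((convex_ball _ _).inter (convex_halfSpace_re_gt 1)).isPreconnected
    have hcV' : c ∈ V := ⟨hcball, hcV⟩
    have hLV : DifferentiableOn ℂ (eulerLog P) V := fun z hz ↦
      (hasDerivAt_eulerLog (P := P) hB hz.2).1.differentiableWithinAt
    have hG'V : DifferentiableOn ℂ G' V := hG'd.mono inter_subset_left
    have hder : V.EqOn (deriv G') (deriv (eulerLog P)) := by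
      intro z hz
      rw [(hG'der z hz.1).deriv]
      -- `deriv Z z = Z z · deriv L z` since `Z = exp ∘ L` near `z`
      have hzo : {w : ℂ | 1 < w.re} ∈ 𝓝 z := (isOpen_lt continuous_const continuous_re).mem_nhds hz.2
      have heq : Z P a =ᶠ[𝓝 z] fun w ↦ exp (eulerLog P w) := by
        filter_upwards [hzo] with w hw
        exact Z_eq_exp_eulerLog hθ.le hN hw
      have hLd := (hasDerivAt_eulerLog (P := P) hB hz.2).1
      rw [heq.deriv_eq, hLd.hasDerivAt.cexp.deriv, ← Z_eq_exp_eulerLog hθ.le hN hz.2,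
        mul_div_cancel_left₀ _ (hf0 z hz.1)]
    have heq := hVo.eqOn_of_deriv_eq hVc hG'V hLV hder hcV' hG'c
    intro z hz hz2
    exact heq ⟨hz, hz2⟩
  refine ⟨G', hG'd, hG'exp, hV, ?_⟩
  -- Borel–Carathéodory on the disc, translated to the origin
  intro z hz
  have hlog1 : 1 ≤ Real.log |t| := one_le_log_abs ht7
  set M : ℝ := 2 * Real.log |t| with hM
  have hM0 : 0 < M := by rw [hM]; linarith
  set f₀ : ℂ → ℂ := fun w ↦ G' (c + w) with hf₀
  have hshift : ∀ w ∈ ball (0 : ℂ) (R₀ θ δ), c + w ∈ ball c (R₀ θ δ) := by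
    intro w hw
    rw [mem_ball_zero_iff] at hw
    rwa [mem_ball, dist_eq_norm, add_sub_cancel_left]
  have hf₀d : DifferentiableOn ℂ f₀ (ball 0 (R₀ θ δ)) := by
    intro w hw
    exact ((hG'd.differentiableAt (isOpen_ball.mem_nhds (hshift w hw))).comp w
      ((differentiableAt_const c).add differentiableAt_id)).differentiableWithinAt
  have hmaps : MapsTo f₀ (ball 0 (R₀ θ δ)) {w | w.re ≤ M} := by
    intro w hw
    have hcw := hshift w hw
    show (G' (c + w)).re ≤ M
    have hre : (G' (c + w)).re = Real.log ‖Z P a (c + w)‖ := by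
      rw [← hG'exp _ hcw, norm_exp, Real.log_exp]
    rw [hre]
    have hζpos : 0 < ‖Z P a (c + w)‖ := norm_pos_iff.mpr (hf0 _ hcw)
    calc Real.log ‖Z P a (c + w)‖ ≤ Real.log (|t| ^ 2) :=
          Real.log_le_log hζpos (norm_Z_le_sq ha hθ0 hN hδ ht hcw)
      _ = M := by rw [Real.log_pow, hM]; norm_num
  have hzc : ‖z - c‖ ≤ r₃ θ δ := by rwa [mem_closedBall, dist_eq_norm] at hz
  have hr₃R : r₃ θ δ < R₀ θ δ := by unfold r₃ R₀; linarith
  have hw : z - c ∈ ball (0 : ℂ) (R₀ θ δ) := by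
    rw [mem_ball_zero_iff]; exact hzc.trans_lt hr₃R
  have key := borelCaratheodory hM0 hf₀d hmaps hR₀ hw
  have hf₀z : f₀ (z - c) = G' z := by simp [hf₀]
  have hf₀0 : f₀ 0 = eulerLog P c := by simp only [hf₀, add_zero]; exact hG'c
  rw [hf₀z, hf₀0] at key
  -- numerical bounds
  have hden : δ / 2 ≤ R₀ θ δ - ‖z - c‖ := by unfold R₀; unfold r₃ at hzc; linarith
  have hδ2pos : 0 < δ / 2 := by linarith
  have hBc : ‖eulerLog P c‖ ≤ BL P := norm_eulerLog_le_BL hB (by rw [hc, dctr_re]; norm_num)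
  have hBL := BL_nonneg P
  have hr₃0 : 0 ≤ r₃ θ δ := by unfold r₃; linarith
  have hr₃le : r₃ θ δ ≤ 5 / 2 := by unfold r₃; linarith
  have hR₀le : R₀ θ δ ≤ 5 / 2 := by unfold R₀; linarith
  have h1 : 2 * M * ‖z - c‖ / (R₀ θ δ - ‖z - c‖) ≤ 2 * M * r₃ θ δ / (δ / 2) :=
    div_le_div₀ (by positivity) (by gcongr) hδ2pos hden
  have h2 : ‖eulerLog P c‖ * (R₀ θ δ + ‖z - c‖) / (R₀ θ δ - ‖z - c‖) ≤
      BL P * (R₀ θ δ + r₃ θ δ) / (δ / 2) :=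
    div_le_div₀ (by positivity) (by gcongr) hδ2pos hden
  have h3 : 2 * M * r₃ θ δ / (δ / 2) + BL P * (R₀ θ δ + r₃ θ δ) / (δ / 2) =
      (4 * M * r₃ θ δ + 2 * BL P * (R₀ θ δ + r₃ θ δ)) / δ := by
    field_simp
    ring
  have h4 : 4 * M * r₃ θ δ + 2 * BL P * (R₀ θ δ + r₃ θ δ) ≤ A₃ P * Real.log |t| := by
    unfold A₃
    rw [hM]
    have hl0 : 0 ≤ Real.log |t| := by linarith
    nlinarith [mul_nonneg hBL hl0, mul_nonneg hBL (sub_nonneg.mpr hlog1)]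
  calc ‖G' z‖ ≤ 2 * M * ‖z - c‖ / (R₀ θ δ - ‖z - c‖) +
        ‖eulerLog P c‖ * (R₀ θ δ + ‖z - c‖) / (R₀ θ δ - ‖z - c‖) := key
    _ ≤ 2 * M * r₃ θ δ / (δ / 2) + BL P * (R₀ θ δ + r₃ θ δ) / (δ / 2) := add_le_add h1 h2
    _ = (4 * M * r₃ θ δ + 2 * BL P * (R₀ θ δ + r₃ θ δ)) / δ := h3
    _ ≤ (A₃ P * Real.log |t|) / δ := div_le_div_of_nonneg_right h4 hδ.le
    _ = A₃ P / δ * Real.log |t| := by ring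

end hyp

end Hilberdink

end Literature.NumberTheory.BeurlingPrimes
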